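import Summits.BirchSwinnertonDyer.Rank1Residual.SecondDescent.BSDpFromSecondDescentNonemptyProp48
import Summits.BirchSwinnertonDyer.Rank1Residual.SecondDescent.BSDpFromSecondDescentNonemptyX4
import HarnessLib

/-!
# `BSD(E,3)` on the `#Ш_an = 81` rows from ONE second-3-descent `NONEMPTY` witness + an independent `Sel₃` partner (X8 / X7 / X6 with either upper half; X4 with Kato's) (cell `b2b-bsdres`, CLASS-CLOSURE instrument B-1 `SEL3CT-ALT`, seat cc-eng-4, GEN 11)

HONEST FRAMING (cell `b2b-bsdres`, run/shared/lean/b2b/bsd-rank1-residual/, verbatim in every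
file): the goal of the cell is to DELETE the COMBINATION-SHAPED residual classes of the
Birch–Swinnerton-Dyer formula for ALL analytic-rank `≤ 1` elliptic curves over `ℚ` — "full BSD
formula for every rank `≤ 1` curve in class `C`" assembled STRICTLY from published theorems — so
that the rank-`≤ 1` remainder becomes exactly the CONSTRUCTION-SHAPED classes, which are TYPED
(missing-input `Prop`s), NOT attempted. This is not "finishing BSD". Per-pair certificate
consumers; NOT class theorems; nothing booked (the lane books); X4 / X6 / X7 / X8 stay as the map
has them (X6 ANNOUNCED, BSTW); rows named are EVIDENCE pointers. THEOREMS ONLY (no definition, no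
named fact, no `sorry`).

## What this file does

The B-1 `NONEMPTY × 2` consumers (`BSDpFromSecondDescentNonempty.lean`, `…Prop48.lean`,
`…X4.lean`; GEN 11 `hcard`-free primes) take TWO second-descent witnesses (`c₁ = 3 • d₁`,
`c₂ = 3 • d₂`).  `ShaDivisibleFromTwoNonempty.lean` Appendix B (GEN 11) shows that ONE witness
suffices for `3³ ∣ #Ш` — `pow_three_dvd_card_sha_of_divisible_of_not_mem`: two `3`-torsion classes
`c₁ ≠ 0`, `c₂ ∉ ℤ∙c₁` of `Ш` with `c₁` a third multiple give `27 ∣ #Ш` — and `3³ ∣ #Ш` is EXACTLY the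
input of the tree's Cassels–Tate parity step `Typed.missingLowerBoundAt_of_casselsTate_of_pow_dvd`
(`k = 2`: `p^(2k-1) ∣ #Ш`), which every consumer below already pays for (`hCT`).  So each theorem
here is the corresponding two-witness consumer with the binders `hcard : #Ш[3] = 9` AND
`hd₂ : 3 • d₂ = c₂` DELETED:

* §0 class-free: `pow_three_dvd_shaOrder_of_divisible_of_not_mem`,
  `missingLowerBoundAt_of_casselsTate_of_one_divisible` (analytic rank `≤ 1`, `ord_p #Ш_an ≤ 4`);
* §1 Wuthrich upper half: `X8/X7.bsdp_three_rankZero_of_casselsTate_of_one_nonempty_of_surj`,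
  `X6.bsdp_three_rankZero_of_casselsTate_of_one_nonempty`;
* §2 Perrin-Riou Prop. 4.8 upper half: the `…_of_prop48…` twins;
* §3 Kato upper half on X4: `X4RankZero.bsdp_three_of_kato_of_casselsTate_of_one_nonempty`
  (+ `…_of_surj9_…`, `…_of_surj_of_ram_…`).

What it buys the instrument: a B-1 row is certified in the `NONEMPTY` direction as soon as ONE of
the two cubics of its independent `Sel₃` pair returns `NONEMPTY(witness)` — the other cubic may
time out, be refused or hit an engine fault (finding F-B1W-1's class) without losing the row; and
a MIXED outcome `NONEMPTY` + certified `EMPTY` on an independent pair is flagged as inconsistent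
with the Cassels–Tate structure (an ANOMALY to report, never a certificate).  Inputs beyond the
pair unchanged: GZK, the Cassels–Tate pairing fact, `sha_dvd_analyticSha` / Prop. 4.8 / Kato
14.5 (3), `hasEntireLFunction_rat`.  Per pair; classes unchanged; nothing booked.
-/

noncomputable section

open scoped Classical

open WeierstrassCurve Literature.NumberTheory.EllipticCurves
  Literature.NumberTheory.EllipticCurves.ModularForms
  Literature.NumberTheory.EllipticCurves.Rank1Residual
  Literature.NumberTheory.EllipticCurves.Rank1Residual.Typed
  Literature.NumberTheory.EllipticCurves.Wuthrich2014
  Literature.NumberTheory.EllipticCurves.PerrinRiou2003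
  Summit.BirchSwinnertonDyer.Rank1Residual.Additive

namespace Summit.BirchSwinnertonDyer.Rank1Residual.SecondDescent

/-! ### §0. Class-free -/

section ClassFree

variable (W : WeierstrassCurve ℚ) [W.IsElliptic] (p : ℕ) [hp : Fact p.Prime]

/-- **`p³ ∣ #Ш(E/ℚ)` from ONE second-descent `NONEMPTY` witness on an independent pair** (finite
`Ш`; classes `c₁ ≠ 0`, `c₂ ∉ ℤ∙c₁` with `p • cᵢ = 0`; `c₁ = p • d` a `p`-th multiple; NO hypothesis
on `#Ш[p]`, NO divisibility of `c₂`), `shaOrder` spelling. Class-free; per pair; nothing booked;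
cc-eng-4 GEN 11. [cite: Creutz2014, §1] [cite: SilvermanAEC2009, Thm. X.4.2(a)] -/
theorem pow_three_dvd_shaOrder_of_divisible_of_not_mem (hfin : W.ShaFinite) {c₁ c₂ d : W.sha}
    (h1 : p • c₁ = 0) (h2 : p • c₂ = 0) (hc₁ : c₁ ≠ 0) (hind : c₂ ∉ AddSubgroup.zmultiples c₁)
    (hd : p • d = c₁) : p ^ 3 ∣ W.shaOrder := by
  haveI : Finite W.sha := hfin
  exact pow_three_dvd_card_sha_of_divisible_of_not_mem W hp.out h1 h2 hc₁ hind hd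

/-- **The typed LOWER half at `p` from ONE `NONEMPTY` witness on an independent pair**, analytic
rank `≤ 1` (`Ш` finite by GZK), `ord_p #Ш_an ≤ 4`: `p³ ∣ #Ш` is exactly the `k = 2` input of the
Cassels–Tate parity step `Typed.missingLowerBoundAt_of_casselsTate_of_pow_dvd`. NO hypothesis on
`#Ш[p]`; ONE divisibility witness. Class-free; per pair; nothing booked; cc-eng-4 GEN 11.
[cite: SilvermanAEC2009, Thm. X.4.14] [cite: Creutz2014, §1] -/
theorem missingLowerBoundAt_of_casselsTate_of_one_divisible
    (hCT : exists_casselsTate_pairing (K := ℚ))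
    (hGZK : rank_eq_analyticRank_of_analyticRank_le_one) (hr : W.analyticRank ≤ 1)
    {c₁ c₂ d : W.sha} (h1 : p • c₁ = 0) (h2 : p • c₂ = 0) (hc₁ : c₁ ≠ 0)
    (hind : c₂ ∉ AddSubgroup.zmultiples c₁) (hd : p • d = c₁) {q : ℚ} (hq : shaAn W = (q : ℂ))
    (hv : padicValRat p q ≤ 4) : MissingLowerBoundAt W p := by
  have hfin : W.ShaFinite := (hGZK W hr).2
  exact missingLowerBoundAt_of_casselsTate_of_pow_dvd W p hCT hfin hq (k := 2) (by omega)
    (pow_three_dvd_shaOrder_of_divisible_of_not_mem W p hfin h1 h2 hc₁ hind hd)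

end ClassFree

/-! ### §1. Wuthrich upper half (`hW`) -/

/-- **X8 ∩ {r_an = 0} ∩ {surj(3)}, `ord₃ #Ш_an ≤ 4`: `BSD(E,3)` from PUBLISHED theorems + ONE
second-`3`-descent `NONEMPTY` witness on an independent `Ш[3]` pair** (= the two-witness consumer
`X8.…_of_two_nonempty_of_surj'` with `hd₂` deleted). Per pair; class X8 unchanged; nothing booked;
cc-eng-4 GEN 11. [cite: Wuthrich2014, Prop. 21 (p. 400)] [cite: SilvermanAEC2009, Thm. X.4.14]
[cite: Creutz2014, §1] [cite: Miller2011LMS, §1 and Def. 1.1] -/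
theorem X8.bsdp_three_rankZero_of_casselsTate_of_one_nonempty_of_surj
    (hCT : exists_casselsTate_pairing (K := ℚ)) (hW : sha_dvd_analyticSha)
    (hGZK : rank_eq_analyticRank_of_analyticRank_le_one) (hmod : hasEntireLFunction_rat)
    (W : WeierstrassCurve ℚ) [W.IsElliptic] [W.IsGloballyMinimal] (hX : ClassX8 W 3) (hs : Surj W 3)
    (hr : W.analyticRank = 0) {c₁ c₂ d : W.sha} (h1 : 3 • c₁ = 0) (h2 : 3 • c₂ = 0)
    (hc₁ : c₁ ≠ 0) (hind : c₂ ∉ AddSubgroup.zmultiples c₁) (hd : 3 • d = c₁)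
    {q : ℚ} (hq : shaAn W = (q : ℂ)) (hv : padicValRat 3 q ≤ 4) : BSDp W 3 :=
  haveI : Fact (Nat.Prime 3) := ⟨Nat.prime_three⟩
  X8.bsdp_of_missingLowerBoundAt_of_surj W 3 hW hGZK hmod hX hs hr
    (missingLowerBoundAt_of_casselsTate_of_one_divisible W 3 hCT hGZK (by omega) h1 h2 hc₁ hind hd
      hq hv)

/-- **X7 ∩ {r_an = 0}, surj(3), `ord₃ #Ш_an ≤ 4`: `BSD(E,3)` from PUBLISHED theorems + ONE
`NONEMPTY` witness on an independent `Ш[3]` pair.** Per pair; class X7 unchanged; nothing booked;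
cc-eng-4 GEN 11. [cite: Wuthrich2014, Prop. 21 (p. 400)] [cite: SilvermanAEC2009, Thm. X.4.14]
[cite: Creutz2014, §1] [cite: Miller2011LMS, §1 and Def. 1.1] -/
theorem X7.bsdp_three_rankZero_of_casselsTate_of_one_nonempty_of_surj
    (hCT : exists_casselsTate_pairing (K := ℚ)) (hW : sha_dvd_analyticSha)
    (hGZK : rank_eq_analyticRank_of_analyticRank_le_one) (hmod : hasEntireLFunction_rat)
    (W : WeierstrassCurve ℚ) [W.IsElliptic] [W.IsGloballyMinimal] (hX : ClassX7 W 3) (hs : Surj W 3)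
    (hr : W.analyticRank = 0) {c₁ c₂ d : W.sha} (h1 : 3 • c₁ = 0) (h2 : 3 • c₂ = 0)
    (hc₁ : c₁ ≠ 0) (hind : c₂ ∉ AddSubgroup.zmultiples c₁) (hd : 3 • d = c₁)
    {q : ℚ} (hq : shaAn W = (q : ℂ)) (hv : padicValRat 3 q ≤ 4) : BSDp W 3 :=
  haveI : Fact (Nat.Prime 3) := ⟨Nat.prime_three⟩
  X7.bsdp_of_missingLowerBoundAt_of_surj W 3 hW hGZK hmod (by norm_num) hX hs hr
    (missingLowerBoundAt_of_casselsTate_of_one_divisible W 3 hCT hGZK (by omega) h1 h2 hc₁ hind hd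
      hq hv)

/-- **X6 ∩ {r_an = 0}, `ord₃ #Ш_an ≤ 4`: `BSD(E,3)` from PUBLISHED theorems + ONE `NONEMPTY` witness
on an independent `Ш[3]` pair** (image proviso automatic for X6). EVIDENCE pointers: the N4@3
canary rows (each certified × 2; the one-witness form is the fallback shape). Per pair; class X6
unchanged; nothing booked; cc-eng-4 GEN 11. [cite: Wuthrich2014, Prop. 21 (p. 400)]
[cite: SilvermanAEC2009, Thm. X.4.14] [cite: Creutz2014, §1] [cite: Miller2011LMS, §1 and Def. 1.1] -/
theorem X6.bsdp_three_rankZero_of_casselsTate_of_one_nonempty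
    (hCT : exists_casselsTate_pairing (K := ℚ)) (hW : sha_dvd_analyticSha)
    (hGZK : rank_eq_analyticRank_of_analyticRank_le_one) (hmod : hasEntireLFunction_rat)
    (W : WeierstrassCurve ℚ) [W.IsElliptic] [W.IsGloballyMinimal] (hX : ClassX6 W 3)
    (hr : W.analyticRank = 0) {c₁ c₂ d : W.sha} (h1 : 3 • c₁ = 0) (h2 : 3 • c₂ = 0)
    (hc₁ : c₁ ≠ 0) (hind : c₂ ∉ AddSubgroup.zmultiples c₁) (hd : 3 • d = c₁)
    {q : ℚ} (hq : shaAn W = (q : ℂ)) (hv : padicValRat 3 q ≤ 4) : BSDp W 3 :=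
  haveI : Fact (Nat.Prime 3) := ⟨Nat.prime_three⟩
  X6.bsdp_of_missingLowerBoundAt_of_analyticRank_eq_zero W 3 hW hGZK hmod (by norm_num) hX hr
    (missingLowerBoundAt_of_casselsTate_of_one_divisible W 3 hCT hGZK (by omega) h1 h2 hc₁ hind hd
      hq hv)

/-! ### §2. Perrin-Riou Prop. 4.8 upper half (`h48`) -/

/-- **X8 ∩ {r_an = 0} ∩ {surj(3)}, upper half from Prop. 4.8: `BSD(E,3)` from ONE `NONEMPTY`
witness on an independent `Ш[3]` pair.** Per pair; class X8 unchanged; nothing booked; cc-eng-4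
GEN 11. [cite: PerrinRiou2003, Prop. 4.8 (p. 162)] [cite: Wuthrich2014, Lemma 20 (p. 399)]
[cite: SilvermanAEC2009, Thm. X.4.14] [cite: Creutz2014, §1] [cite: Miller2011LMS, §1 and Def. 1.1] -/
theorem X8.bsdp_three_rankZero_of_casselsTate_of_one_nonempty_of_prop48_of_surj
    (hCT : exists_casselsTate_pairing (K := ℚ)) (h48 : prop48_padicValRat_bsd_rank_zero_le)
    (hGZK : rank_eq_analyticRank_of_analyticRank_le_one) (hmod : hasEntireLFunction_rat)
    (W : WeierstrassCurve ℚ) [W.IsElliptic] [W.IsGloballyMinimal] (hX : ClassX8 W 3) (hs : Surj W 3)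
    (hr : W.analyticRank = 0) {c₁ c₂ d : W.sha} (h1 : 3 • c₁ = 0) (h2 : 3 • c₂ = 0)
    (hc₁ : c₁ ≠ 0) (hind : c₂ ∉ AddSubgroup.zmultiples c₁) (hd : 3 • d = c₁)
    {q : ℚ} (hq : shaAn W = (q : ℂ)) (hv : padicValRat 3 q ≤ 4) : BSDp W 3 :=
  Supersingular.X8.bsdp_of_missingLowerBoundAt_of_prop48_of_surj W 3 h48 hGZK hmod hX hs hr
    (missingLowerBoundAt_of_casselsTate_of_one_divisible W 3 hCT hGZK (by omega) h1 h2 hc₁ hind hd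
      hq hv)

/-- **X7 ∩ {r_an = 0}, surj(3), upper half from Prop. 4.8: `BSD(E,3)` from ONE `NONEMPTY` witness
on an independent `Ш[3]` pair.** Per pair; class X7 unchanged; nothing booked; cc-eng-4 GEN 11.
[cite: PerrinRiou2003, Prop. 4.8 (p. 162)] [cite: Wuthrich2014, Lemma 20 (p. 399)]
[cite: SilvermanAEC2009, Thm. X.4.14] [cite: Creutz2014, §1] [cite: Miller2011LMS, §1 and Def. 1.1] -/
theorem X7.bsdp_three_rankZero_of_casselsTate_of_one_nonempty_of_prop48_of_surj
    (hCT : exists_casselsTate_pairing (K := ℚ)) (h48 : prop48_padicValRat_bsd_rank_zero_le)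
    (hGZK : rank_eq_analyticRank_of_analyticRank_le_one) (hmod : hasEntireLFunction_rat)
    (W : WeierstrassCurve ℚ) [W.IsElliptic] [W.IsGloballyMinimal] (hX : ClassX7 W 3) (hs : Surj W 3)
    (hr : W.analyticRank = 0) {c₁ c₂ d : W.sha} (h1 : 3 • c₁ = 0) (h2 : 3 • c₂ = 0)
    (hc₁ : c₁ ≠ 0) (hind : c₂ ∉ AddSubgroup.zmultiples c₁) (hd : 3 • d = c₁)
    {q : ℚ} (hq : shaAn W = (q : ℂ)) (hv : padicValRat 3 q ≤ 4) : BSDp W 3 :=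
  Supersingular.X7.bsdp_of_missingLowerBoundAt_of_prop48_of_surj W 3 h48 hGZK hmod (by norm_num) hX hs
    hr
    (missingLowerBoundAt_of_casselsTate_of_one_divisible W 3 hCT hGZK (by omega) h1 h2 hc₁ hind hd
      hq hv)

/-- **X6 ∩ {r_an = 0}, upper half from Prop. 4.8, NO image binder: `BSD(E,3)` from ONE `NONEMPTY`
witness on an independent `Ш[3]` pair.** Per pair; class X6 unchanged; nothing booked; cc-eng-4
GEN 11. [cite: PerrinRiou2003, Prop. 4.8 (p. 162)] [cite: Serre1972, §5.4 Prop. 21 i)]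
[cite: SilvermanAEC2009, Thm. X.4.14] [cite: Creutz2014, §1] [cite: Miller2011LMS, §1 and Def. 1.1] -/
theorem X6.bsdp_three_rankZero_of_casselsTate_of_one_nonempty_of_prop48
    (hCT : exists_casselsTate_pairing (K := ℚ)) (h48 : prop48_padicValRat_bsd_rank_zero_le)
    (hGZK : rank_eq_analyticRank_of_analyticRank_le_one) (hmod : hasEntireLFunction_rat)
    (W : WeierstrassCurve ℚ) [W.IsElliptic] [W.IsGloballyMinimal] (hX : ClassX6 W 3)
    (hr : W.analyticRank = 0) {c₁ c₂ d : W.sha} (h1 : 3 • c₁ = 0) (h2 : 3 • c₂ = 0)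
    (hc₁ : c₁ ≠ 0) (hind : c₂ ∉ AddSubgroup.zmultiples c₁) (hd : 3 • d = c₁)
    {q : ℚ} (hq : shaAn W = (q : ℂ)) (hv : padicValRat 3 q ≤ 4) : BSDp W 3 :=
  Supersingular.X6.bsdp_of_missingLowerBoundAt_of_prop48 W 3 h48 hGZK hmod (by norm_num) hX hr
    (missingLowerBoundAt_of_casselsTate_of_one_divisible W 3 hCT hGZK (by omega) h1 h2 hc₁ hind hd
      hq hv)

/-! ### §3. Kato upper half on X4 (additive at `3`, potentially good, big image) -/

section X4

variable (W : WeierstrassCurve ℚ) [W.IsElliptic] [W.IsGloballyMinimal]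

/-- **X4 ∩ {r_an = 0}, `p = 3` potentially good, `ρ̄_{E,3^n}` onto for all `n`, `3 ∤ ∏ c_ℓ · c_D`,
`ord₃ #Ш_an ≤ 4`: `BSD(E,3)` from Kato's upper half + ONE second-`3`-descent `NONEMPTY` witness on
an independent `Ш[3]` pair** (= `X4RankZero.bsdp_three_of_kato_of_casselsTate_of_two_nonempty'`
with `hd₂` deleted). Per pair; class X4 unchanged; nothing booked; cc-eng-4 GEN 11.
[cite: Kato2004Asterisque, Thm. 14.5 (3) (p. 236)] [cite: SilvermanAEC2009, Thm. X.4.14]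
[cite: Creutz2014, §1] [cite: Miller2011LMS, §1 and Def. 1.1] -/
theorem X4RankZero.bsdp_three_of_kato_of_casselsTate_of_one_nonempty
    (hKato : Kato2004.rankZero_padicValNat_sha_le_of_additive_potGood_of_imageContainsSL2)
    (hGZK : rank_eq_analyticRank_of_analyticRank_le_one) (hmod : hasEntireLFunction_rat)
    (hCT : exists_casselsTate_pairing (K := ℚ))
    (hr : W.analyticRank = 0) (hX : ClassX4 W 3) (hpot : 0 ≤ padicValRat 3 W.j)
    (hsurj : ∀ n : ℕ, W.HasSurjectiveModNGaloisRep (3 ^ n : ℕ)) (htam : ¬ 3 ∣ W.tamagawaProduct)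
    {N : ℕ} [NeZero N] (D : ModularParametrizationData W N) (hc : ¬ (3 : ℤ) ∣ D.maninConstant)
    {c₁ c₂ d : W.sha} (h1 : 3 • c₁ = 0) (h2 : 3 • c₂ = 0) (hc₁ : c₁ ≠ 0)
    (hind : c₂ ∉ AddSubgroup.zmultiples c₁) (hd : 3 • d = c₁)
    {q : ℚ} (hq : shaAn W = (q : ℂ)) (hv : padicValRat 3 q ≤ 4) : BSDp W 3 :=
  haveI : Fact (Nat.Prime 3) := ⟨Nat.prime_three⟩
  X4RankZero.bsdp_of_missingLowerBoundAt_of_kato W 3 hKato hGZK hmod hr hX hpot hsurj htam D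
    (by exact_mod_cast hc)
    (missingLowerBoundAt_of_casselsTate_of_one_divisible W 3 hCT hGZK (by rw [hr]; exact zero_le_one)
      h1 h2 hc₁ hind hd hq hv)

/-- **The same with `ρ̄_{E,9}` onto** (tower surjectivity from level `9`) — the ONE-witness shape of
the `#Ш_an = 81` X4 window row `19215t1` (certified × 2; fallback shape). Per pair; nothing booked;
cc-eng-4 GEN 11. [cite: Kato2004Asterisque, Thm. 14.5 (3) (p. 236)] [cite: SilvermanAEC2009, Thm. X.4.14]
[cite: Creutz2014, §1] [cite: Miller2011LMS, §1 and Def. 1.1] -/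
theorem X4RankZero.bsdp_three_of_kato_of_surj9_of_casselsTate_of_one_nonempty
    (hKato : Kato2004.rankZero_padicValNat_sha_le_of_additive_potGood_of_imageContainsSL2)
    (hGZK : rank_eq_analyticRank_of_analyticRank_le_one) (hmod : hasEntireLFunction_rat)
    (hCT : exists_casselsTate_pairing (K := ℚ))
    (hr : W.analyticRank = 0) (hX : ClassX4 W 3) (hpot : 0 ≤ padicValRat 3 W.j)
    (h9 : W.HasSurjectiveModNGaloisRep 9) (htam : ¬ 3 ∣ W.tamagawaProduct)
    {N : ℕ} [NeZero N] (D : ModularParametrizationData W N) (hc : ¬ (3 : ℤ) ∣ D.maninConstant)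
    {c₁ c₂ d : W.sha} (h1 : 3 • c₁ = 0) (h2 : 3 • c₂ = 0) (hc₁ : c₁ ≠ 0)
    (hind : c₂ ∉ AddSubgroup.zmultiples c₁) (hd : 3 • d = c₁)
    {q : ℚ} (hq : shaAn W = (q : ℂ)) (hv : padicValRat 3 q ≤ 4) : BSDp W 3 :=
  X4RankZero.bsdp_three_of_kato_of_casselsTate_of_one_nonempty W hKato hGZK hmod hCT hr hX hpot
    (WeierstrassCurve.forall_hasSurjectiveModNGaloisRep_three_pow_of_nine W h9) htam D hc h1 h2 hc₁
    hind hd hq hv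

/-- **The same in the census shape surj(3) ∧ ram(3)** (tower surjectivity by
`hasSurjectiveModNGaloisRep_pow_of_hasMultiplicativeReductionAtPrime`). Per pair; nothing booked;
cc-eng-4 GEN 11. [cite: Kato2004Asterisque, Thm. 14.5 (3) (p. 236), (12.5.2) (p. 222)]
[cite: BurungaleSkinnerTianWan2024, Part II (sur), (ram) (p. 74)] [cite: SilvermanAEC2009, Thm. X.4.14]
[cite: Creutz2014, §1] [cite: Miller2011LMS, §1 and Def. 1.1] -/
theorem X4RankZero.bsdp_three_of_kato_of_surj_of_ram_of_casselsTate_of_one_nonempty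
    (hKato : Kato2004.rankZero_padicValNat_sha_le_of_additive_potGood_of_imageContainsSL2)
    (hGZK : rank_eq_analyticRank_of_analyticRank_le_one) (hmod : hasEntireLFunction_rat)
    (hCT : exists_casselsTate_pairing (K := ℚ))
    (hr : W.analyticRank = 0) (hX : ClassX4 W 3) (hpot : 0 ≤ padicValRat 3 W.j) (hs : Surj W 3)
    (hram : Ram W 3) (htam : ¬ 3 ∣ W.tamagawaProduct)
    {N : ℕ} [NeZero N] (D : ModularParametrizationData W N) (hc : ¬ (3 : ℤ) ∣ D.maninConstant)
    {c₁ c₂ d : W.sha} (h1 : 3 • c₁ = 0) (h2 : 3 • c₂ = 0) (hc₁ : c₁ ≠ 0)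
    (hind : c₂ ∉ AddSubgroup.zmultiples c₁) (hd : 3 • d = c₁)
    {q : ℚ} (hq : shaAn W = (q : ℂ)) (hv : padicValRat 3 q ≤ 4) : BSDp W 3 :=
  haveI : Fact (Nat.Prime 3) := ⟨Nat.prime_three⟩
  X4RankZero.bsdp_three_of_kato_of_casselsTate_of_one_nonempty W hKato hGZK hmod hCT hr hX hpot
    (hasSurjectiveModNGaloisRep_pow_of_hasMultiplicativeReductionAtPrime W 3 hs hram) htam D hc h1 h2
    hc₁ hind hd hq hv

end X4

end Summit.BirchSwinnertonDyer.Rank1Residual.SecondDescent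

end
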